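import Literature.MathematicalPhysics.QuantumFieldTheory.Balaban1983to89.B9Thm37GlueTorusCovLevelsTower

/-!
# `Balaban1983to89.B9Thm37GlueTorusCovTower` — THE k-FOLD COMB TOWER: the averaging levels j = 0, 1, …, k built
# from a sequence of combs K₀, K₁, … (label sites and ORDERED-PRODUCT transports, the Q_j(U)-shape of (3.19) for
# arbitrary j), every level a Poincaré level with a recursive explicit constant, and the coercivity constant σ_k
# for the (k+1)-level operator Δ_U + Σ_{l≤k} a_l·G_lᵀG_l of (3.16) with the cover over ALL levels
# (MODEL; own lineage pv21; imports `B9Thm37GlueTorusCovLevelsTower` only; modifies nothing)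

References (bib keys; the tags below cite only these):
* [B9] = `Balaban1985BackgroundPropagators` — T. Bałaban, *Propagators for lattice gauge theories in a background
  field*, Commun. Math. Phys. 99 (1985) 389–434.
* [B7] = `Balaban1985Averaging` — T. Bałaban, *Averaging operations for lattice gauge theories*, Commun. Math. Phys.
  98 (1985) 17–51 (= reference [5] of [B9]; only NAMED, through `B9Thm37GlueTorusCovComp`).

THE PRINTED LOCI.  NO new «» span in this file; everything printed is only NAMED and is certified in the headers of
modules in the import closure: [B9] (3.16) p. 393 (⟨A, Q\*aQA⟩ = Σ_{j=0}^{k} a Σ_{b∈Λ_j} (L^jη)^{d−2}|(Q_j(U)A)(b)|²,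
`B9Thm37GlueTorusCovLevels`), (3.15)/(3.18)–(3.19) p. 393 (Q_j(U) = Q(Ū^{j−1})⋯Q(U) as ordered products,
`B9Thm37GlueTorusCov`, `B9Thm37GlueTorusCovComp`), (3.3) pp. 390–391 (∇_U, `B9Thm37Glue`), (3.23)–(3.24) p. 394
(Δ′_a = Δ_U + Q′\*aQ′), p. 394 (Ω₀Δ′_aΩ₀ and its inverse G′, `B9Thm37GlueTorusInv`), p. 395 (positivity of Δ′_a
and of G′, `B9Thm37Glue`).  NOTHING printed is asserted as a theorem — every declaration below is a MODEL
definition or a kernel-checked theorem about the component model of the lineage (`B9Thm37Glue.covD`,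
`B9Thm37GlueTorusCov.Comb`, `B9Thm37GlueTorusCovComp.mmul`/`gMean`, `B9Thm37GlueTorusCovLevels.levelOp`,
`B9Thm37GlueTorusCovLevelsPoinc.gdev`/`sigmaL`, `B9Thm37GlueTorusCovLevelsTower.cBlk`/`cTr`,
`B9Thm37GlueTorusInv.dirInv`).

THE POINT (value = a MODEL kernel certificate steering the lineage; NOT summit progress).
`B9Thm37GlueTorusCovLevels` fixed a THREE-level family (k = 2) and `B9Thm37GlueTorusCovLevelsTower` made its
composite level a Poincaré level, recording in its honest scope (ii) "only the three-level family is discharged (a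
k-fold tower would iterate §1; not done here)".  Print's (3.16) has j = 0, …, k for the number k of renormalization
steps.  THIS FILE builds the tower for ARBITRARY k and iterates the composition:
 * §1 THE TOWER.  For a sequence of combs K_j : `Comb src tgt (B_j)` on the same sites (dependent block types) and
   a bond transport Rm: `towerBlk` (level 0: x ↦ x; level j+1: x ↦ base_j(blk_j(towerBlk j x)), the representative
   site after j+1 averagings) and `towerTr` (level 0: 1; level j+1: x ↦ tr_j(towerBlk j x)·towerTr j x, the ordered
   product of the comb holonomies — `B9Thm37GlueTorusCovComp.mmul`); all tower transports are isometries for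
   isometric bond matrices (`towerTr_orth`, induction with `mmul_orth`); level j+1 IS, definitionally, the
   composite (`cBlk`/`cTr` of `B9Thm37GlueTorusCovLevelsTower`) of tower level j with the comb level of K_j
   (`gdev_tower_succ_eq`), and level 0 has deviation 0 (`gdev_tower_zero`).
 * §2 COUNTING.  `towerN n` (1, n₀, n₀n₁, …): if the blocks of K_j have ≤ n_j sites then the level-j blocks of the
   tower (fibres of `towerBlk j`) have ≤ towerN n j sites (`card_towerBlk_fibre_le`, induction with
   `B9Thm37GlueTorusCovLevelsTower.card_base_blk_fibre_le` and a bounded-union count).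
 * §3 EVERY TOWER LEVEL IS A POINCARÉ LEVEL.  `towerP c_min D n` (P₀ = 0, P_{j+1} = 2P_j + 2·towerN n j·D_j n_j/c_min²)
   and **`tower_dev_sq_le`**: Σ_xΣ_i gdev_j(x,i)² ≤ P_j·Σ_b ((∇_U f)(b))² for EVERY j, EVERY field and EVERY
   transport (induction with `B9Thm37GlueTorusCovLevelsTower.compose_dev_bound` and
   `B9Thm37GlueTorusCovLevelsPoinc.sum_dev_sq_le`; K_j of depth ≤ D_j with blocks of ≤ n_j sites, |c(b)| ≥ c_min > 0).
 * §4 THE (k+1)-LEVEL OPERATOR `towerOp` = `B9Thm37GlueTorusCovLevels.levelOp` over J = Fin (k+1) with the tower's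
   blockings and transports and BLOCK weights w_l ∘ towerBlk_l: **`coercive_towerOp`** σ_k·Σ_p f(p)² ≤
   Σ_p f(p)((Δ_U + Σ_{l≤k} a_l G_lᵀG_l)f)(p) for every f each site of whose support has SOME level l ≤ k with
   a_l ≥ a_min and block weight ≥ w_min, σ_k = `sigmaTower a_min w_min c_min D n k` =
   ((a_min w_min²)⁻¹ + Σ_{l≤k} P_l)⁻¹ > 0 (`sigmaTower_pos`; σ₀ = a_min w_min², `sigmaTower_level_zero`) — the same
   σ_k for every transport and every volume; strict positivity of the form on covered supports (`posDef_towerOp`);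
   the ℓ² bounds σ_k⁻¹ for the inverse under a full cover (`inverse_sq_le_towerOp`) and for the DIRICHLET inverse
   under a cover of Ω₀ = {χ = 1} only (`towerDir_sq_le`).
 * §5 THE TORUS `UT N` with cube combs of sides M_j (1 ≤ M_j, M_j ∣ N_i): D_j = d(M_j − 1), n_j = M_j^d
   (`B9Thm37GlueTorusCovPoinc.tdepth_le`, `card_block_le`), σ_k = `sigmaTowerTorus d M a_min w_min c_min k` —
   independent of N and of the transport (`coercive_towerOp_torus`, `inverse_sq_le_towerOp_torus`,
   `towerDir_sq_le_torus`).

NOT ASSERTED, NOT MODELLED (honest scope).  (i) As in the import closure: the averaged configurations Ū^i of [B7]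
(42)–(43) are NOT constructed; the tower transports are ordered products of comb holonomies of U ITSELF (print's
Q(Ū^{j−1})⋯Q(U) is modelled only up to Ū^i ↦ transport data); no regularity of U is used or concluded.  (ii) The
constants are crude: P_j grows like 2^j times products of block sizes (already P₁ = 2D₀n₀/c_min² is twice the
one-comb constant of `B9Thm37GlueTorusCovLevelsPoinc`, `towerP_one`), σ_k is ONE global constant (the reciprocal
of the SUM of all level constants) — not print's scale-dependent local O((L^jη)²) bounds; print's factors
(L^jη)^{d−2}, L^{−jd} and the nesting of the block sides (M_j need not divide M_{j+1}) are not tracked.  (iii) ℓ²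
bounds only: no decay of the inverses, nothing of (3.17), Theorems 3.1–3.3, Corollary 3.6, Theorem 3.7 or
(1.31)/Proposition 1.1 of [B9]; the capstones of the chain are not re-wired.  (iv) Component site fields
`St × Cp → ℝ`.  (v) The three-level family of `B9Thm37GlueTorusCovLevels` is the case k = 2 in substance but is not
re-derived from the tower here (its level-1 transport is tr₀(x), the tower's is tr₀(x)·1).  Value = MODEL kernel
certificate, NOT summit progress; NOT continuum, NOT Clay, NOT a claim about print.
-/

namespace Literature.MathematicalPhysics.QuantumFieldTheory.Balaban1983to89.B9Thm37GlueTorusCovTower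

open Finset B9Thm37Sum B9Thm37Glue B9Thm37GlueTorusInv B9Thm37GlueTorusCov B9Thm37GlueTorusCovComp
  B9Thm37GlueTorusCovPoinc B9Thm37GlueTorusCovLevels B9Thm37GlueTorusCovLevelsPoinc B9Thm37GlueTorusCovLevelsTower
open B5TorusCover (UT Ctr ctrU)

noncomputable section

/-! ## §1  The tower: representative sites and ordered-product transports -/

section Tower

variable {St Bd Cp : Type} [Fintype Cp] [DecidableEq Cp] {src tgt : Bd → St} {Bs : ℕ → Type}
  (Ks : ∀ j, Comb src tgt (Bs j)) (Rm : Bd → Cp → Cp → ℝ)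

/-- MODEL bookkeeping: the representative site of x at tower level j — level 0: x itself; level j+1: the base point
of the K_j-block of the level-j representative. [cite: Balaban1985BackgroundPropagators, (3.19) p.393] -/
def towerBlk : ℕ → St → St
  | 0 => fun x => x
  | j + 1 => fun x => (Ks j).base ((Ks j).blk (towerBlk j x))

/-- MODEL bookkeeping: the transport of tower level j — level 0: the identity matrix; level j+1: the ORDERED
PRODUCT (K_j-holonomy at the level-j representative)·(level-j transport) (`B9Thm37GlueTorusCovComp.mmul`).
[cite: Balaban1985BackgroundPropagators, (3.19) p.393] -/
def towerTr : ℕ → St → Cp → Cp → ℝ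
  | 0 => fun _ i k => if i = k then 1 else 0
  | j + 1 => fun x => mmul ((Ks j).tr Rm (towerBlk Ks j x)) (towerTr j x)

omit [Fintype Cp] [DecidableEq Cp] in
/-- Level 0 representative: x. [folklore] -/
theorem towerBlk_zero (x : St) : towerBlk Ks 0 x = x := rfl

omit [Fintype Cp] [DecidableEq Cp] in
/-- Level j+1 representative: base_j(blk_j(level-j representative)). [folklore] -/
theorem towerBlk_succ (j : ℕ) (x : St) :
    towerBlk Ks (j + 1) x = (Ks j).base ((Ks j).blk (towerBlk Ks j x)) := rfl

/-- Level 0 transport: the identity matrix. [folklore] -/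
theorem towerTr_zero (x : St) (i k : Cp) : towerTr Ks Rm 0 x i k = if i = k then 1 else 0 := rfl

/-- Level j+1 transport: the ordered product. [folklore] -/
theorem towerTr_succ (j : ℕ) (x : St) :
    towerTr Ks Rm (j + 1) x = mmul ((Ks j).tr Rm (towerBlk Ks j x)) (towerTr Ks Rm j x) := rfl

/-- **All tower transports are isometries** when every bond matrix is (induction: `one_orth`, `Comb.tr_orth`,
`mmul_orth`). [folklore] -/
theorem towerTr_orth (hRm : ∀ b i j, ∑ k, Rm b k i * Rm b k j = if i = j then (1 : ℝ) else 0) :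
    ∀ j x i i', ∑ k, towerTr Ks Rm j x k i * towerTr Ks Rm j x k i' = if i = i' then (1 : ℝ) else 0 := by
  intro j
  induction j with
  | zero => exact fun _ => one_orth
  | succ j ih => exact fun x => mmul_orth ((Ks j).tr_orth Rm hRm _) (ih x)

/-- Level 0 has deviation 0. [folklore] -/
theorem gdev_tower_zero (f : St × Cp → ℝ) (x : St) (i : Cp) :
    gdev (towerBlk Ks 0) (towerTr Ks Rm 0) (fun y => y) f x i = 0 := by
  show (∑ k, (if i = k then (1 : ℝ) else 0) * f (x, k)) - f (x, i) = 0
  rw [one_reproduces, sub_self]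

/-- **Level j+1 IS the composite** (`B9Thm37GlueTorusCovLevelsTower.cBlk`/`cTr`) of tower level j (label sites,
base map the identity) with the comb level of K_j — definitionally. [cite: Balaban1985BackgroundPropagators, (3.19) p.393] -/
theorem gdev_tower_succ_eq (j : ℕ) (f : St × Cp → ℝ) (x : St) (i : Cp) :
    gdev (towerBlk Ks (j + 1)) (towerTr Ks Rm (j + 1)) (fun y => y) f x i =
      gdev (cBlk (towerBlk Ks j) (fun y => y) (Ks j).blk)
        (cTr (towerBlk Ks j) (fun y => y) (towerTr Ks Rm j) ((Ks j).tr Rm)) (Ks j).base f x i := rfl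

/-- **The level-(j+1) deviation**: (K_j-holonomy at the level-j representative)·(level-j deviation at x) + (comb
deviation of K_j at the level-j representative). [folklore] -/
theorem gdev_tower_succ (j : ℕ) (f : St × Cp → ℝ) (x : St) (i : Cp) :
    gdev (towerBlk Ks (j + 1)) (towerTr Ks Rm (j + 1)) (fun y => y) f x i =
      (∑ m, (Ks j).tr Rm (towerBlk Ks j x) i m * gdev (towerBlk Ks j) (towerTr Ks Rm j) (fun y => y) f x m) +
        dev (Ks j) Rm f (towerBlk Ks j x) i := by
  rw [gdev_tower_succ_eq, gdev_compose]
  rfl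

end Tower

/-! ## §2  Counting: the level-j blocks of the tower -/

section Counting

variable {St Bd : Type} {src tgt : Bd → St} {Bs : ℕ → Type} (Ks : ∀ j, Comb src tgt (Bs j))

/-- MODEL bookkeeping: the block-size bound of tower level j — 1, n₀, n₀n₁, … . [folklore] -/
def towerN (n : ℕ → ℕ) : ℕ → ℕ
  | 0 => 1
  | j + 1 => n j * towerN n j

/-- towerN at level 0 is 1. [folklore] -/
theorem towerN_zero (n : ℕ → ℕ) : towerN n 0 = 1 := rfl

/-- towerN at level j+1 is n_j·towerN j. [folklore] -/
theorem towerN_succ (n : ℕ → ℕ) (j : ℕ) : towerN n (j + 1) = n j * towerN n j := rfl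

variable [Fintype St] [DecidableEq St] [∀ j, DecidableEq (Bs j)]

/-- **Fibre bound of the tower**: if the blocks of K_j have ≤ n_j sites for every j, the fibres of `towerBlk j` have
≤ towerN n j sites (level 0: singletons; level j+1: a fibre is a union, over the ≤ n_j sites z whose K_j-block
base point is y, of level-j fibres). [folklore] -/
theorem card_towerBlk_fibre_le {n : ℕ → ℕ}
    (hn : ∀ j β, (univ.filter fun x => (Ks j).blk x = β).card ≤ n j) :
    ∀ j y, (univ.filter fun x => towerBlk Ks j x = y).card ≤ towerN n j := by
  intro j
  induction j with
  | zero =>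
      intro y
      rw [towerN_zero]
      refine Finset.card_le_one.mpr fun a ha b hb => ?_
      simp only [Finset.mem_filter, Finset.mem_univ, true_and, towerBlk_zero] at ha hb
      rw [ha, hb]
  | succ j ih =>
      intro y
      have hsub : (univ.filter fun x => towerBlk Ks (j + 1) x = y) ⊆
          (univ.filter fun z => (Ks j).base ((Ks j).blk z) = y).biUnion
            (fun z => univ.filter fun x => towerBlk Ks j x = z) := by
        intro x hx
        simp only [Finset.mem_filter, Finset.mem_univ, true_and, Finset.mem_biUnion, towerBlk_succ] at hx ⊢
        exact ⟨towerBlk Ks j x, hx, rfl⟩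
      calc (univ.filter fun x => towerBlk Ks (j + 1) x = y).card
          ≤ ((univ.filter fun z => (Ks j).base ((Ks j).blk z) = y).biUnion
              (fun z => univ.filter fun x => towerBlk Ks j x = z)).card := Finset.card_le_card hsub
        _ ≤ ∑ z ∈ univ.filter (fun z => (Ks j).base ((Ks j).blk z) = y),
              (univ.filter fun x => towerBlk Ks j x = z).card := Finset.card_biUnion_le
        _ ≤ ∑ z ∈ univ.filter (fun z => (Ks j).base ((Ks j).blk z) = y), towerN n j :=
            Finset.sum_le_sum fun z _ => ih z
        _ = (univ.filter fun z => (Ks j).base ((Ks j).blk z) = y).card * towerN n j := by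
            rw [Finset.sum_const, smul_eq_mul]
        _ ≤ n j * towerN n j := Nat.mul_le_mul_right _ (card_base_blk_fibre_le (Ks j) (hn j) y)

end Counting

/-! ## §3  Every tower level is a Poincaré level -/

section Deviation

variable {St Bd Cp : Type} [Fintype Cp] [DecidableEq Cp] {src tgt : Bd → St} {Bs : ℕ → Type}
  (Ks : ∀ j, Comb src tgt (Bs j)) (Rm : Bd → Cp → Cp → ℝ)

/-- MODEL bookkeeping: **the deviation constants of the tower** — P₀ = 0, P_{j+1} = 2·P_j + 2·towerN n j·(D_j n_j/c_min²)
(`B9Thm37GlueTorusCovLevelsTower.compose_dev_bound` iterated). [folklore] -/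
def towerP (cmin : ℝ) (D n : ℕ → ℕ) : ℕ → ℝ
  | 0 => 0
  | j + 1 => 2 * towerP cmin D n j + 2 * (towerN n j : ℝ) * ((D j : ℝ) * (n j) * (cmin ^ 2)⁻¹)

/-- P₀ = 0. [folklore] -/
theorem towerP_zero (cmin : ℝ) (D n : ℕ → ℕ) : towerP cmin D n 0 = 0 := rfl

/-- P_{j+1} = 2P_j + 2·towerN n j·D_j n_j/c_min². [folklore] -/
theorem towerP_succ (cmin : ℝ) (D n : ℕ → ℕ) (j : ℕ) :
    towerP cmin D n (j + 1) =
      2 * towerP cmin D n j + 2 * (towerN n j : ℝ) * ((D j : ℝ) * (n j) * (cmin ^ 2)⁻¹) := rfl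

/-- P₁ = 2·D₀n₀/c_min² — twice the one-comb constant of `B9Thm37GlueTorusCovLevelsPoinc.sum_dev_sq_le` (the split
(u + v)² ≤ 2u² + 2v² of `compose_dev_bound` is applied even where the inner deviation vanishes; crude but uniform).
[folklore] -/
theorem towerP_one (cmin : ℝ) (D n : ℕ → ℕ) :
    towerP cmin D n 1 = 2 * ((D 0 : ℝ) * (n 0) * (cmin ^ 2)⁻¹) := by
  rw [towerP_succ, towerP_zero, towerN_zero, Nat.cast_one]
  ring

/-- The tower constants are ≥ 0. [folklore] -/
theorem towerP_nonneg (cmin : ℝ) (D n : ℕ → ℕ) : ∀ j, 0 ≤ towerP cmin D n j := by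
  intro j
  induction j with
  | zero => exact le_rfl
  | succ j ih =>
      rw [towerP_succ]
      positivity

variable [Fintype St] [DecidableEq St] [Fintype Bd] [∀ j, Fintype (Bs j)] [∀ j, DecidableEq (Bs j)]

/-- **EVERY TOWER LEVEL IS A POINCARÉ LEVEL.**  Isometric bond matrices, |c(b)| ≥ c_min > 0, K_j of depth ≤ D_j with
blocks of ≤ n_j sites: Σ_xΣ_i gdev_j(x,i)² ≤ P_j·Σ_b ((∇_U f)(b))² for every level j, every field and every
transport (induction: level 0 has deviation 0; the step is `compose_dev_bound` with the comb bound `sum_dev_sq_le`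
of K_j and the fibre bound `card_towerBlk_fibre_le`). [folklore] -/
theorem tower_dev_sq_le (hRm : ∀ b i j, ∑ k, Rm b k i * Rm b k j = if i = j then (1 : ℝ) else 0)
    {c : Bd → ℝ} {cmin : ℝ} (hcmin : 0 < cmin) (hc : ∀ b, cmin ≤ |c b|) {D n : ℕ → ℕ}
    (hD : ∀ j x, (Ks j).depth x ≤ D j) (hn : ∀ j β, (univ.filter fun x => (Ks j).blk x = β).card ≤ n j) :
    ∀ j (f : St × Cp → ℝ),
      ∑ x, ∑ i, gdev (towerBlk Ks j) (towerTr Ks Rm j) (fun y => y) f x i ^ 2 ≤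
        towerP cmin D n j * ∑ b, covD src tgt c Rm f b ^ 2 := by
  intro j
  induction j with
  | zero =>
      intro f
      rw [towerP_zero, zero_mul]
      simp only [gdev_tower_zero]
      simp
  | succ j ih =>
      intro f
      rw [towerP_succ]
      simp only [gdev_tower_succ_eq]
      exact compose_dev_bound (towerBlk Ks j) (fun y => y) (towerTr Ks Rm j) (Ks j).blk (Ks j).base
        ((Ks j).tr Rm) ((Ks j).tr_orth Rm hRm) (card_towerBlk_fibre_le Ks hn j) f (ih f)
        (sum_dev_sq_le (Ks j) c Rm hRm hcmin hc (hD j) (hn j) f)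

end Deviation

/-! ## §4  The (k+1)-level operator and its coercivity with the cover over all levels -/

section Operator

variable {St Bd Cp : Type} [Fintype St] [DecidableEq St] [Fintype Bd] [Fintype Cp] [DecidableEq Cp]
  {src tgt : Bd → St} {Bs : ℕ → Type} [∀ j, Fintype (Bs j)] [∀ j, DecidableEq (Bs j)]
  (Ks : ∀ j, Comb src tgt (Bs j)) (Rm : Bd → Cp → Cp → ℝ)

/-- **MODEL of Δ_U + Q\*aQ with k+1 tower levels**: Δ_U + Σ_{l=0}^{k} a_l·G_lᵀG_l, the level operator of
`B9Thm37GlueTorusCovLevels` over J = Fin (k+1) with the tower's representatives and transports, site weights W_l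
(regions Λ_l = {W_l ≠ 0}) and coefficients a_l. [cite: Balaban1985BackgroundPropagators, (3.16) p.393 + (3.23)–(3.24) p.394] -/
def towerOp (c : Bd → ℝ) (k : ℕ) (W : Fin (k + 1) → St → ℝ) (a : Fin (k + 1) → ℝ) :
    Module.End ℝ (St × Cp → ℝ) :=
  levelOp src tgt c Rm (fun l : Fin (k + 1) => towerBlk Ks (l : ℕ)) W (fun l => towerTr Ks Rm (l : ℕ)) a

/-- MODEL bookkeeping: **the coercivity constant of the tower**, σ_k = ((a_min w_min²)⁻¹ + Σ_{l≤k} P_l)⁻¹ =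
`sigmaL a_min w_min (Σ_{l : Fin (k+1)} towerP c_min D n l)`. [folklore] -/
def sigmaTower (amin wmin cmin : ℝ) (D n : ℕ → ℕ) (k : ℕ) : ℝ :=
  sigmaL amin wmin (∑ l : Fin (k + 1), towerP cmin D n (l : ℕ))

/-- σ_k > 0 for a_min, w_min > 0. [folklore] -/
theorem sigmaTower_pos {amin wmin : ℝ} (cmin : ℝ) (D n : ℕ → ℕ) (k : ℕ) (hamin : 0 < amin)
    (hwmin : 0 < wmin) : 0 < sigmaTower amin wmin cmin D n k :=
  sigmaL_pos hamin hwmin (Finset.sum_nonneg fun l _ => towerP_nonneg cmin D n l)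

/-- σ₀ (one level: the identity, P₀ = 0) is a_min·w_min². [folklore] -/
theorem sigmaTower_level_zero (amin wmin cmin : ℝ) (D n : ℕ → ℕ) :
    sigmaTower amin wmin cmin D n 0 = amin * wmin ^ 2 := by
  unfold sigmaTower sigmaL
  rw [Fin.sum_univ_one]
  show ((amin * wmin ^ 2)⁻¹ + towerP cmin D n 0)⁻¹ = amin * wmin ^ 2
  rw [towerP_zero, add_zero, inv_inv]

/-- **COERCIVITY OF THE TOWER OPERATOR WITH THE COVER OVER ALL k+1 LEVELS, UNIFORM IN THE TRANSPORT** (block weights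
W_l = w_l ∘ towerBlk_l; all a_l ≥ 0; isometric bond matrices; |c(b)| ≥ c_min > 0; K_j of depth ≤ D_j with blocks of
≤ n_j sites).  If every site x of the support of f has SOME level l ≤ k with a_l ≥ a_min and |w_l(towerBlk_l x)| ≥
w_min, then σ_k·Σ_p f(p)² ≤ Σ_p f(p)((Δ_U + Σ_{l≤k} a_l G_lᵀG_l)f)(p), σ_k = `sigmaTower a_min w_min c_min D n k`.
[cite: Balaban1985BackgroundPropagators, (3.16) p.393 + (3.23)–(3.24) p.394 + p.395] -/
theorem coercive_towerOp (hRm : ∀ b i j, ∑ k, Rm b k i * Rm b k j = if i = j then (1 : ℝ) else 0)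
    {c : Bd → ℝ} {cmin : ℝ} (hcmin : 0 < cmin) (hc : ∀ b, cmin ≤ |c b|) {D n : ℕ → ℕ}
    (hD : ∀ j x, (Ks j).depth x ≤ D j) (hn : ∀ j β, (univ.filter fun x => (Ks j).blk x = β).card ≤ n j)
    (k : ℕ) (w : Fin (k + 1) → St → ℝ) {a : Fin (k + 1) → ℝ} (ha : ∀ l, 0 ≤ a l) {amin wmin : ℝ}
    (hamin : 0 < amin) (hwmin : 0 < wmin) (f : St × Cp → ℝ)
    (hcov : ∀ x i, f (x, i) ≠ 0 → ∃ l : Fin (k + 1), amin ≤ a l ∧ wmin ≤ |w l (towerBlk Ks (l : ℕ) x)|) :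
    sigmaTower amin wmin cmin D n k * ∑ p, f p ^ 2 ≤
      ∑ p, f p * towerOp Ks Rm c k (fun l x => w l (towerBlk Ks (l : ℕ) x)) a f p :=
  coercive_levelOp src tgt c Rm (fun l : Fin (k + 1) => towerBlk Ks (l : ℕ)) w
    (fun l => towerTr Ks Rm (l : ℕ)) (fun _ y => y) a univ (fun l _ => towerTr_orth Ks Rm hRm (l : ℕ)) ha
    (fun l _ => towerP_nonneg cmin D n (l : ℕ))
    (fun l _ f => tower_dev_sq_le Ks Rm hRm hcmin hc hD hn (l : ℕ) f) hamin hwmin f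
    fun x i h => by obtain ⟨l, hl⟩ := hcov x i h; exact ⟨l, mem_univ _, hl⟩

/-- **Strict positivity of the tower operator's form on covered supports** (no reproduction hypothesis).
[cite: Balaban1985BackgroundPropagators, (3.16) p.393 + p.395] -/
theorem posDef_towerOp (hRm : ∀ b i j, ∑ k, Rm b k i * Rm b k j = if i = j then (1 : ℝ) else 0)
    {c : Bd → ℝ} {cmin : ℝ} (hcmin : 0 < cmin) (hc : ∀ b, cmin ≤ |c b|) {D n : ℕ → ℕ}
    (hD : ∀ j x, (Ks j).depth x ≤ D j) (hn : ∀ j β, (univ.filter fun x => (Ks j).blk x = β).card ≤ n j)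
    (k : ℕ) (w : Fin (k + 1) → St → ℝ) {a : Fin (k + 1) → ℝ} (ha : ∀ l, 0 ≤ a l) {amin wmin : ℝ}
    (hamin : 0 < amin) (hwmin : 0 < wmin) (f : St × Cp → ℝ) (hf : f ≠ 0)
    (hcov : ∀ x i, f (x, i) ≠ 0 → ∃ l : Fin (k + 1), amin ≤ a l ∧ wmin ≤ |w l (towerBlk Ks (l : ℕ) x)|) :
    0 < ∑ p, f p * towerOp Ks Rm c k (fun l x => w l (towerBlk Ks (l : ℕ) x)) a f p := by
  have hco := coercive_towerOp Ks Rm hRm hcmin hc hD hn k w ha hamin hwmin f hcov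
  have hσ := sigmaTower_pos cmin D n k hamin hwmin
  have hf2 : 0 < ∑ p, f p ^ 2 := by
    obtain ⟨p, hp⟩ := Function.ne_iff.mp hf
    have hp' : f p ≠ 0 := hp
    exact lt_of_lt_of_le (by positivity) (Finset.single_le_sum (fun q _ => sq_nonneg (f q)) (mem_univ p))
  exact lt_of_lt_of_le (mul_pos hσ hf2) hco

/-- **ℓ² bound of the inverse of the tower operator, uniform in the transport**, when the k+1 levels cover all sites:
Σ_p ((…)⁻¹g)(p)² ≤ σ_k⁻²·Σ_p g(p)². [folklore] -/
theorem inverse_sq_le_towerOp (hRm : ∀ b i j, ∑ k, Rm b k i * Rm b k j = if i = j then (1 : ℝ) else 0)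
    {c : Bd → ℝ} {cmin : ℝ} (hcmin : 0 < cmin) (hc : ∀ b, cmin ≤ |c b|) {D n : ℕ → ℕ}
    (hD : ∀ j x, (Ks j).depth x ≤ D j) (hn : ∀ j β, (univ.filter fun x => (Ks j).blk x = β).card ≤ n j)
    (k : ℕ) (w : Fin (k + 1) → St → ℝ) {a : Fin (k + 1) → ℝ} (ha : ∀ l, 0 ≤ a l) {amin wmin : ℝ}
    (hamin : 0 < amin) (hwmin : 0 < wmin)
    (hcov : ∀ x, ∃ l : Fin (k + 1), amin ≤ a l ∧ wmin ≤ |w l (towerBlk Ks (l : ℕ) x)|) (g : St × Cp → ℝ) :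
    ∑ p, (Ring.inverse (towerOp Ks Rm c k (fun l x => w l (towerBlk Ks (l : ℕ) x)) a) g) p ^ 2 ≤
      (sigmaTower amin wmin cmin D n k ^ 2)⁻¹ * ∑ p, g p ^ 2 :=
  inverse_sq_le_levelOp src tgt c Rm (fun l : Fin (k + 1) => towerBlk Ks (l : ℕ)) w
    (fun l => towerTr Ks Rm (l : ℕ)) (fun _ y => y) a univ (fun l _ => towerTr_orth Ks Rm hRm (l : ℕ)) ha
    (fun l _ => towerP_nonneg cmin D n (l : ℕ))
    (fun l _ f => tower_dev_sq_le Ks Rm hRm hcmin hc hD hn (l : ℕ) f) hamin hwmin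
    (fun x => by obtain ⟨l, hl⟩ := hcov x; exact ⟨l, mem_univ _, hl⟩) g

/-- **ℓ² bound of the DIRICHLET INVERSE of the tower operator on Ω₀ = {χ = 1}, uniform in the transport**, when the
k+1 levels cover Ω₀ (χ {0,1}-valued): Σ_p (G′g)(p)² ≤ σ_k⁻²·Σ_p g(p)².
[cite: Balaban1985BackgroundPropagators, (3.16) p.393 + p.394 + p.395] -/
theorem towerDir_sq_le (hRm : ∀ b i j, ∑ k, Rm b k i * Rm b k j = if i = j then (1 : ℝ) else 0)
    {c : Bd → ℝ} {cmin : ℝ} (hcmin : 0 < cmin) (hc : ∀ b, cmin ≤ |c b|) {D n : ℕ → ℕ}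
    (hD : ∀ j x, (Ks j).depth x ≤ D j) (hn : ∀ j β, (univ.filter fun x => (Ks j).blk x = β).card ≤ n j)
    (k : ℕ) (w : Fin (k + 1) → St → ℝ) {a : Fin (k + 1) → ℝ} (ha : ∀ l, 0 ≤ a l) {amin wmin : ℝ}
    (hamin : 0 < amin) (hwmin : 0 < wmin) {χ : St × Cp → ℝ} (hχ : ∀ p, χ p = 0 ∨ χ p = 1)
    (hcov : ∀ x i, χ (x, i) = 1 → ∃ l : Fin (k + 1), amin ≤ a l ∧ wmin ≤ |w l (towerBlk Ks (l : ℕ) x)|)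
    (g : St × Cp → ℝ) :
    ∑ p, (dirInv (towerOp Ks Rm c k (fun l x => w l (towerBlk Ks (l : ℕ) x)) a) χ g) p ^ 2 ≤
      (sigmaTower amin wmin cmin D n k ^ 2)⁻¹ * ∑ p, g p ^ 2 :=
  levelDir_sq_le src tgt c Rm (fun l : Fin (k + 1) => towerBlk Ks (l : ℕ)) w
    (fun l => towerTr Ks Rm (l : ℕ)) (fun _ y => y) a univ (fun l _ => towerTr_orth Ks Rm hRm (l : ℕ)) ha
    (fun l _ => towerP_nonneg cmin D n (l : ℕ))
    (fun l _ f => tower_dev_sq_le Ks Rm hRm hcmin hc hD hn (l : ℕ) f) hamin hwmin hχ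
    (fun x i h => by obtain ⟨l, hl⟩ := hcov x i h; exact ⟨l, mem_univ _, hl⟩) g

end Operator

/-! ## §5  The torus: cube combs of sides M₀, M₁, … -/

section Torus

variable {d : ℕ} {N : Fin d → ℕ} [∀ i, NeZero (N i)] [NeZero d]

/-- MODEL bookkeeping: the tower of lexicographic cube combs of sides M_j on the torus `UT N`
(`B9Thm37GlueTorusCov.torusComb`; 1 ≤ M_j, M_j ∣ N_i). [cite: Balaban1985BackgroundPropagators, (3.15) p.393] -/
def torusTower {M : ℕ → ℕ} (hM : ∀ j, 1 ≤ M j) (hdiv : ∀ j i, M j ∣ N i) :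
    ∀ j, Comb (B9Thm37GluePU.bsrc (N := N)) (B9Thm37GluePU.btgt (N := N)) (Ctr N (M j)) :=
  fun j => torusComb (hM j) (hdiv j)

/-- MODEL bookkeeping: **the tower coercivity constant on the torus**, σ_k(d, M, a_min, w_min, c_min) =
`sigmaTower a_min w_min c_min (j ↦ d(M_j − 1)) (j ↦ M_j^d) k` — independent of the volume N and of the transport.
[folklore] -/
def sigmaTowerTorus (d : ℕ) (M : ℕ → ℕ) (amin wmin cmin : ℝ) (k : ℕ) : ℝ :=
  sigmaTower amin wmin cmin (fun j => d * (M j - 1)) (fun j => M j ^ d) k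

/-- σ_k > 0 on the torus. [folklore] -/
theorem sigmaTowerTorus_pos (d : ℕ) (M : ℕ → ℕ) {amin wmin : ℝ} (cmin : ℝ) (k : ℕ) (hamin : 0 < amin)
    (hwmin : 0 < wmin) : 0 < sigmaTowerTorus d M amin wmin cmin k :=
  sigmaTower_pos cmin _ _ k hamin hwmin

/-- **COERCIVITY OF THE TOWER OPERATOR ON THE TORUS WITH THE COVER OVER ALL k+1 LEVELS, UNIFORM IN THE VOLUME AND THE
TRANSPORT**: σ_k(d, M, a_min, w_min, c_min)·Σ_p f(p)² ≤ Σ_p f(p)(… f)(p).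
[cite: Balaban1985BackgroundPropagators, (3.16) p.393 + (3.23)–(3.24) p.394 + p.395] -/
theorem coercive_towerOp_torus {Cp : Type} [Fintype Cp] [DecidableEq Cp] {M : ℕ → ℕ} (hM : ∀ j, 1 ≤ M j)
    (hdiv : ∀ j i, M j ∣ N i) {Rm : UT N × Fin d → Cp → Cp → ℝ}
    (hRm : ∀ b i j, ∑ k, Rm b k i * Rm b k j = if i = j then (1 : ℝ) else 0) {c : UT N × Fin d → ℝ}
    {cmin : ℝ} (hcmin : 0 < cmin) (hc : ∀ b, cmin ≤ |c b|) (k : ℕ) (w : Fin (k + 1) → UT N → ℝ)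
    {a : Fin (k + 1) → ℝ} (ha : ∀ l, 0 ≤ a l) {amin wmin : ℝ} (hamin : 0 < amin) (hwmin : 0 < wmin)
    (f : UT N × Cp → ℝ)
    (hcov : ∀ x i, f (x, i) ≠ 0 → ∃ l : Fin (k + 1), amin ≤ a l ∧
      wmin ≤ |w l (towerBlk (torusTower hM hdiv) (l : ℕ) x)|) :
    sigmaTowerTorus d M amin wmin cmin k * ∑ p, f p ^ 2 ≤
      ∑ p, f p * towerOp (torusTower hM hdiv) Rm c k
        (fun l x => w l (towerBlk (torusTower hM hdiv) (l : ℕ) x)) a f p :=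
  coercive_towerOp (torusTower hM hdiv) Rm hRm hcmin hc (fun j x => tdepth_le (hM j) x)
    (fun j z => card_block_le (hM j) (hdiv j) z) k w ha hamin hwmin f hcov

/-- **ℓ² bound of the inverse of the tower operator on the torus, uniform in the volume and the transport**, the
k+1 levels covering all sites: Σ_p ((…)⁻¹g)(p)² ≤ σ_k⁻²·Σ_p g(p)². [folklore] -/
theorem inverse_sq_le_towerOp_torus {Cp : Type} [Fintype Cp] [DecidableEq Cp] {M : ℕ → ℕ} (hM : ∀ j, 1 ≤ M j)
    (hdiv : ∀ j i, M j ∣ N i) {Rm : UT N × Fin d → Cp → Cp → ℝ}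
    (hRm : ∀ b i j, ∑ k, Rm b k i * Rm b k j = if i = j then (1 : ℝ) else 0) {c : UT N × Fin d → ℝ}
    {cmin : ℝ} (hcmin : 0 < cmin) (hc : ∀ b, cmin ≤ |c b|) (k : ℕ) (w : Fin (k + 1) → UT N → ℝ)
    {a : Fin (k + 1) → ℝ} (ha : ∀ l, 0 ≤ a l) {amin wmin : ℝ} (hamin : 0 < amin) (hwmin : 0 < wmin)
    (hcov : ∀ x, ∃ l : Fin (k + 1), amin ≤ a l ∧ wmin ≤ |w l (towerBlk (torusTower hM hdiv) (l : ℕ) x)|)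
    (g : UT N × Cp → ℝ) :
    ∑ p, (Ring.inverse (towerOp (torusTower hM hdiv) Rm c k
        (fun l x => w l (towerBlk (torusTower hM hdiv) (l : ℕ) x)) a) g) p ^ 2 ≤
      (sigmaTowerTorus d M amin wmin cmin k ^ 2)⁻¹ * ∑ p, g p ^ 2 :=
  inverse_sq_le_towerOp (torusTower hM hdiv) Rm hRm hcmin hc (fun j x => tdepth_le (hM j) x)
    (fun j z => card_block_le (hM j) (hdiv j) z) k w ha hamin hwmin hcov g

/-- **ℓ² bound of the DIRICHLET INVERSE of the tower operator on the torus region Ω₀ = {χ = 1}, uniform in the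
volume and the transport**, the k+1 levels covering Ω₀: Σ_p (G′g)(p)² ≤ σ_k⁻²·Σ_p g(p)².
[cite: Balaban1985BackgroundPropagators, (3.16) p.393 + p.394 + p.395] -/
theorem towerDir_sq_le_torus {Cp : Type} [Fintype Cp] [DecidableEq Cp] {M : ℕ → ℕ} (hM : ∀ j, 1 ≤ M j)
    (hdiv : ∀ j i, M j ∣ N i) {Rm : UT N × Fin d → Cp → Cp → ℝ}
    (hRm : ∀ b i j, ∑ k, Rm b k i * Rm b k j = if i = j then (1 : ℝ) else 0) {c : UT N × Fin d → ℝ}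
    {cmin : ℝ} (hcmin : 0 < cmin) (hc : ∀ b, cmin ≤ |c b|) (k : ℕ) (w : Fin (k + 1) → UT N → ℝ)
    {a : Fin (k + 1) → ℝ} (ha : ∀ l, 0 ≤ a l) {amin wmin : ℝ} (hamin : 0 < amin) (hwmin : 0 < wmin)
    {χ : UT N × Cp → ℝ} (hχ : ∀ p, χ p = 0 ∨ χ p = 1)
    (hcov : ∀ x i, χ (x, i) = 1 → ∃ l : Fin (k + 1), amin ≤ a l ∧
      wmin ≤ |w l (towerBlk (torusTower hM hdiv) (l : ℕ) x)|) (g : UT N × Cp → ℝ) :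
    ∑ p, (dirInv (towerOp (torusTower hM hdiv) Rm c k
        (fun l x => w l (towerBlk (torusTower hM hdiv) (l : ℕ) x)) a) χ g) p ^ 2 ≤
      (sigmaTowerTorus d M amin wmin cmin k ^ 2)⁻¹ * ∑ p, g p ^ 2 :=
  towerDir_sq_le (torusTower hM hdiv) Rm hRm hcmin hc (fun j x => tdepth_le (hM j) x)
    (fun j z => card_block_le (hM j) (hdiv j) z) k w ha hamin hwmin hχ hcov g

end Torus

end

end Literature.MathematicalPhysics.QuantumFieldTheory.Balaban1983to89.B9Thm37GlueTorusCovTower
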